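import Mathlib
import Summits.MatrixMultiplication.MatrixMultiplication.Theorems.SnSubsetDichotomyNoThresholdSubsetTriplePlancherelStepDefs
import Literature.RepresentationTheory.FiniteGroups.KLRGradedCellularBasis

/-!
# DEV rungs v2 — what is DONE and the next kernel-checked STATEMENTS (lead c7, end of cycle 7)

Crux stmt-MatrixMultiplication-8302 `SnSubsetDichotomy.NoThresholdSubsetTriple`, line `klr-graded-polynomial-method`; report
`Cruxes/NoThresholdSubsetTriple/Lines/klr_graded_polynomial_method-lead-c7.md`.  This crux workfile FILES NOTHING (`sorry` allowed).

DONE in the tree during cycle 7 (namespace `Summit.MatrixMultiplication.MatrixMultiplication.Theorems`, objects `PlancherelStep.*`):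
  Freedman `stub_freedman_exp` · (Q)-lemma `selfBounding_timeSum_tail` · GNW `transProb_sum_eq_one` · hook ratio `transProb_mul_card_stdFilling` ·
  up-branching `sum_card_stdFilling_insert` · mass factor `transProb_insert_of_ne` · `incr_insert_of_ne` · `incr_insert_succ` · `incr_sub_incr_abs_le` ·
  (L2′) `sq_change_le` · (L3) `condVar_le` · (L2)-box `sq_change_le_of_box`, `sqEnergy_le_of_box` · `abs_incr_le_of_bounded` · `sum_mul_sum_erase_antisymm_eq_zero`.
(The v1 statements of this file — `DevRungs.massFactor/transProb_sum/sq_change_le/condVar_le` — are all theorems now, under the names above.)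

STATUS (end of cycle 7): M2 `prefix_block_card` DONE (p157166), M3 `pairQV_tail_of_drift` DONE (p160069, with `PlancherelStep.DriftHypothesis`
p158702, model theorem `condExp_prefix_succ` p158534, two-process (Q)-lemma p158025).  The statements below are kept as the record of what was planned; both
`sorry`s are now tree theorems under the same names in namespace `…Theorems`.  REMAINING = OPEN MATHEMATICS: (L1*) DriftHypothesis, (E′) for (M), (HK).

ORIGINAL PLAN TEXT — NEXT (the MODEL theorem, formalisable; and (L1*), open):
* `prefix_block_card`      — M2: under the uniform measure on `TableauPair n` the block of a prefix sub-tableau `U` (entries `< t` of the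
                               second tableau, shape `Y`, |Y| = t) has `t! · #block(U) = n! · f^Y`; hence (with `transProb_mul_card_stdFilling`)
                               the conditional law of the next shape given the past is `transProb` — the Plancherel growth is the prefix-shape
                               process of a uniform same-shape pair.            [downward induction on t with `sum_card_stdFilling_insert`]
* `driftHypothesis`        — (L1*) as a `Prop` (the one OPEN deterministic input of (Q)): some Lyapunov functional `V ≥ q/C₀` restores at
                               rate `c·q/√n` on the box (lead c7 report §2a: the inverse-local-density renormalised energy passes numerically).
* `pairQV_tail_of_drift`   — M3 (target of the DEV line's (Q) half): `driftHypothesis` ⟹ the tableau-COUNTING form of (Q):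
                               `#{(λ,S,T) boxed : Σ_t q(ν_t(T)) ≥ A·n√n} ≤ n! · 2e^{−κA√n}` — from M2 (model), `selfBounding_timeSum_tail`
                               (abstract), `sq_change_le_of_box` (L2), `condVar_le` (L3).  Stated below with the constants left existential.
-/

set_option linter.dupNamespace false

noncomputable section

open scoped BigOperators
open Literature.RepresentationTheory.FiniteGroups (addableNodes IsAddableNode TableauPair)
open Literature.NumberTheory.DiophantineGeometry (StdFilling)

namespace Summit.MatrixMultiplication.MatrixMultiplication.Cruxes.NoThresholdSubsetTriple.DevRungs2

open Summit.MatrixMultiplication.MatrixMultiplication.Theorems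
open Summit.MatrixMultiplication.MatrixMultiplication.Theorems.PlancherelStep

/-- M2 — BLOCK COUNTING (the model theorem's combinatorial core).  For `t ≤ n`, a Young diagram `Y` with `t` cells and a standard
filling `U` of `Y` by `0 … t−1`: the same-shape pairs `(λ, S, T)` of size `n` whose second tableau `T` extends `U` (entry `k < t` of `T`
sits in the cell `U k`) number `n!·f^Y / t!`.  Proof sketch: downward induction on `t` from `t = n` (`#block = f^λ`: `T = U`, `S` free);
the block of `U` is the disjoint union over the addable nodes `y` of `Y` of the blocks of `U` extended by `t ↦ y`, and
`Σ_y (n!/(t+1)!)·f^{Y∪y} = (n!/t!)·f^Y` by `sum_card_stdFilling_insert`. [lead c7 report §4] -/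
theorem prefix_block_card (n t : ℕ) (ht : t ≤ n) (Y : YoungDiagram) (hY : Y.cells.card = t) (U : StdFilling t Y) :
    t.factorial * Nat.card {ω : TableauPair n // ∀ k : Fin t, (ω.2.2).1 ⟨k.1, lt_of_lt_of_le k.2 ht⟩ = U.1 k} =
      n.factorial * Nat.card (StdFilling t Y) := by
  sorry

/-- The shape of the entries `< t` of a growth sequence `f : Fin n → ℕ × ℕ` (so `shapeBefore f 0 = ∅`; compare `prefixCells f k` =
entries `≤ k`). -/
def shapeBefore {n : ℕ} (f : Fin n → ℕ × ℕ) (t : ℕ) : Finset (ℕ × ℕ) :=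
  (Finset.univ.filter fun j : Fin n => j.1 < t).image f

/-- (L1*) — THE OPEN DETERMINISTIC INPUT, as a hypothesis: a Lyapunov shape functional `V` with `q ≤ C₀·V`, `V ∅ = 0`, restoring drift
`E[ΔV | ν] ≤ K − c·q(ν)/√n`, bounded increments `|ΔV| ≤ b√n` and conditional second moment `≤ C(q+1)`, for every Young diagram in the
`3√n`-box (the numerically passing candidate is `V = q + Σ_y p_y x̂_y²` with charges renormalised by the inverse local transition density;
lead c7 report §2a). -/
def driftHypothesis : Prop :=
  ∃ (V : Finset (ℕ × ℕ) → ℝ) (C₀ K c b C : ℝ), 0 < C₀ ∧ 0 < c ∧ 0 < b ∧ 0 < C ∧ V ∅ = 0 ∧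
    (∀ ν : Finset (ℕ × ℕ), IsLowerSet (ν : Set (ℕ × ℕ)) → 0 ≤ V ν ∧ sqEnergy ν ≤ C₀ * V ν) ∧
    ∀ (n : ℕ) (ν : Finset (ℕ × ℕ)), IsLowerSet (ν : Set (ℕ × ℕ)) → ν.card ≤ n →
      (∀ x ∈ ν, (x.1 : ℝ) < 3 * Real.sqrt n ∧ (x.2 : ℝ) < 3 * Real.sqrt n) →
        (∑ z ∈ addableNodes ν, transProb ν z * (V (insert z ν) - V ν) ≤ K - c * sqEnergy ν / Real.sqrt n) ∧
        (∀ z ∈ addableNodes ν, |V (insert z ν) - V ν| ≤ b * Real.sqrt n) ∧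
        (∑ z ∈ addableNodes ν, transProb ν z * (V (insert z ν) - V ν) ^ 2 ≤ C * (sqEnergy ν + 1))

/-- M3 — THE COUNTING FORM OF (Q) MODULO (L1*): target statement of the DEV line's quadratic-variation half.  Under `driftHypothesis`
there are `κ > 0`, `A₀`, `n₀` such that for `n ≥ n₀` and `A ≥ A₀` the boxed same-shape pairs whose second tableau has time-summed
conditional second moment `Σ_{t<n} q(ν_t) ≥ A·n·√n` number at most `n!·2e^{−κA√n}`.  Proof plan: M2 (the prefix-shape process under the
uniform measure on `TableauPair n` is Markov with kernel `transProb`; Mathlib `Filtration`/`condExp` on the finite space) + the abstract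
lemma `selfBounding_timeSum_tail` with `q_t = V(ν_t)`-drift from `driftHypothesis`, (L2)/(L3) for `V` from the hypothesis, and the counting
dictionary `μ.real E = #E / n!`. [lead c7 report §2a, §4] -/
theorem pairQV_tail_of_drift (h : driftHypothesis) :
    ∃ κ : ℝ, 0 < κ ∧ ∃ A₀ : ℝ, ∃ n₀ : ℕ, ∀ n ≥ n₀, ∀ A : ℝ, A₀ ≤ A →
      (Nat.card {ω : TableauPair n //
          (ω.1.youngDiagram.rowLen 0 : ℝ) < 3 * Real.sqrt n ∧ (ω.1.youngDiagram.colLen 0 : ℝ) < 3 * Real.sqrt n ∧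
          A * n * Real.sqrt n ≤ ∑ t ∈ Finset.range n, sqEnergy (shapeBefore (ω.2.2).1 t)} : ℝ) ≤
        (n.factorial : ℝ) * (2 * Real.exp (-(κ * A * Real.sqrt n))) := by
  sorry

end Summit.MatrixMultiplication.MatrixMultiplication.Cruxes.NoThresholdSubsetTriple.DevRungs2

end
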